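import Summits.QuantumFields.YangMills.Theses.BalabanUVNodes
import Summits.QuantumFields.YangMills.Theorems.BalabanUVNodesN27AtAllPinsOfRecord13CoPHVCutBFreeBareLedgerReadingKernelFaces
import Summits.QuantumFields.YangMills.Theorems.BalabanUVNodesN20OffLiveOneTermReading
import Summits.QuantumFields.YangMills.Theorems.BalabanUVNodesN22AtRecordOfGenAnalyticReadingRoad1

/-!
# ★★ LEAF AWBⱽ-1T-K-N22J61 (dag-n27-c g19) — LEAF AWBⱽ-1T-K (`…VBFreeBareLedgerReadingOneTermKernelFaces`) WITH THE N22 FACE PRODUCED BY dag-n22-c's ROAD 1 IN GENERATOR CURRENCY WITH THE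
# OLDER-TERM SCHEMA DISCHARGED FROM THE ANALYTIC READING (module J61 §2 `n22At_u3OfRecord₁₃_of_genAnalyticReadingRoad1`, on J57; towers `Gn`, domains `Adm`, reading `Pot ρA A`): node U3's displayed share = `hs hκ hcr hκ₀` · the (D4)-type letter at every pair `hK` · the N18 FACE `h18` (displayed, as in the base
# leaf — ROAD 1 does not read node N18 for N22) · (1.21) `hlim` · J61 §2's rows — NO N22 face ∕ letter row, NO N18 letter, NO second-order schema, NO output bound, NO sector datum.

Cell `pub-ymgap`, HUMAN RULING D-0062 Track A; R134 seat `pub-ymgap-dag-n27-c` (N27 B5 composite, s2), gen 19, trigger (t2⁗) «a NEW producer of a kernel FACE in the limit currency»: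
dag-n22-c g18 J61 p660852 `…N22AtRecordOfGenAnalyticReadingRoad1` §2 ★★★ `YMDAG.N22.KernelFading.n22At_u3OfRecord₁₃_of_genAnalyticReadingRoad1` (⊢ `∀ k, N22At (u3OfRecord₁₃ θ (objectsOfRecord₁₃ F N θ ℓ)
k)` — this lane's `h22` binder); K3⁸ `SpineGivenEndpointR13SepCoPHV` = stmt-QuantumFields-27366 (skeleton v6 b4e55110ab73e679), `--kind proof --supports 27366 --as helper`; COUNT-NEUTRAL.
ONE theorem, 0 `def`, 0 `sorry`; `N = 2`; guard `ZhUnity ∧ SlotsNondegenerate₁₃`; route-facing; namespace `…Theorems.BalabanUVNodesN27SpineRecord`.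

WHAT IS KERNEL-CHECKED ([bookkeeping]; the base leaf B `…OneTermKernelFaces` (p650834) ∕ plug C (p650950) VERBATIM except the `h22'` line and the swapped rows): ★★★
`spineGivenEndpointR13SepCoPHV_of_liveV5PinsAtCrOfRecord₁₃VAt_cut_bareLedgerReadingV_kernelFaces_n22GenAnalyticReadingRoad1_offLiveOneTerm_v5pins_bFree` ⊢ **`SpineGivenEndpointR13SepCoPHV` BY
NAME**.  `h22' :=` J61 §2 applied per guarded admissible tuple to the displayed rows (J61 §2's binders VERBATIM under `x ↦ x F θ`, `N ↦ 2`, `θ ↦ θ.toStage13Params`, EVERY row guarded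
`Provisos₁₃CoPH → guard → Admissible →`; `0 < θ.γ` from `Admissible`; J61's bound histories `g` renamed `gh`, J61's `hκ₀` (the `κ∕2`
threshold) renamed `hκh` — this file's `g` being node N16's letter and `hκ₀` node U3's threshold row); `h18` is the base leaf's displayed N18 FACE (no `h18'`: ROAD 1 has no N18 letter).
Displayed: the four pins · `h16` · `hs hκ hcr hκ₀` · `hK` · `h18` · type letters `𝔸 Ec`, `m' M hM`, GENERATOR towers `Gn`, reading maps `emb`, (1.21) `hlim`, W1-20's law `hloc` at the run towers `truncRun K (toClusterTower (Gn F θ K))`, space tables `sp`,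
numerals `κ κE δ₀ B₃ r ℓ₁ R r₀ ϱ Mb cw ω₁` and families `lam aw`, admissibility domains `Adm` with `hκh hδ₀ hB₃ hr hκE`, (Adm-run) `hAdm`, the ANALYTIC READING (AR): `Pot ρA A` with
`hGA hA hMbA hAdmr hρ₁`, weight table rows `haw haw0 hawω hcw`, `hMb0 hϱ hR`, the LAST-coupling first-order schema `hGt` (`lam ≤ ℓ₁`), `hlam hℓ₁ hω₁`, complexified readings `ι Φ U` with `hU hrU hEhol hΦemb hΦsp`, site weights `w` with `hw₀ hw htail`, ROAD 1's
letter rows `hμω` (`ω₁ + 4M_b c_w∕ϱ ≤ ω` — pub-balaban's `fade_of_radius` clause in the record's letters), `hℓκ`, `hrow` · `hβ23 hβ1 hmatch hend hradii hclass hH3 hsel3 hβw` · live `hζm h20 h21 hlinkBareV` · off-live ONE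
row `htarget`.  The schema-rowed parent is G4 `…OneTermN22GenStepLipschitz` (p657056).

HONEST FRAMING (binding): COMPOSITE-node bookkeeping BY NAME; a REDUCTION, not a discharge; every displayed row a HYPOTHESIS or a decided MODEL (0∕1 today; K0⁷ OPEN).  Per dag-n22-c's own
framing of J57∕J61: NE9 ∕ NE5 are NOT IN PRINT for d = 4; (AR) ∕ (G-T1-last) ∕ (Adm-run) are the n22 cell's UNPRINTED hypothesis SHAPES on def-W1's generator ([II] (2.14)–(2.15) p. 15, GAPS G-ne9p2-5; (pub-balaban GAPS G-t4-U3-1∕-3: [I] prints the recursion (0.23)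
p. 256, (2.12)–(2.13) p. 268 and the C^∞ clause p. 263 without constants — NOTHING quantitative in the older couplings); ROAD 1 carries the clause `ω₁ + 4M_b c_w∕ϱ ≤ ℓ.ω < 1` in the record's
letters (dag-n22-a's `sticky_not_fadingMemory`: no fading without it on that road); readings ∕ tails ∕ law are NODE A ∕ N09 ∕ N10 ∕ def-W1 objects; `h18` and `hK` are node N18's ∕ the
(D4)-type faces (NOT PRINTED for d = 4).  `hlinkBareV` = NODE O's world (UNPRINTED content, 0 instances); N11 NOT READ; `hβw` = K1's window currency (K1⁹ OPEN); nothing of Bałaban's or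
King's asserted or instantiated; NOT `stub_rates13HV` ∕ `stub_expansion13HV`; N14–N22 ∕ N27 NOT discharged (the chair books, R417); K3⁸ OPEN, NOT claimed; counts UNMOVED (typed 28∕28 ·
discharged 5∕27, A 5∕28); one finite four-torus programme at fixed `ε` — NOT ℝ⁴, NOT OS, NOT a mass gap, NOT Clay.  No decl below carries a cite tag.
-/



set_option autoImplicit false

namespace Summit.QuantumFields.YangMills.Theorems.BalabanUVNodesN27SpineRecord
open scoped BigOperators Matrix Matrix.Norms.L2Operator
open Finset MeasureTheory
open Literature.MathematicalPhysics.QuantumFieldTheory.Balaban1983to89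
open T4OutputRate T4RecentScale T4GoodClassBudget T4CauchySum T4TowerRateComposition T4TowerRateDischarge
open T4EtaRateMin (Readings NE3Shape)
open T4RateLiaison (GaugeDominated)
open FlowStep (RGEqH prefixOf)
open TreeLengthTorus (TFaceConnected torusTreeLen)
open B12TreeDecay (kappa₀)
open Summit.QuantumFields.BalabanUV.T4Continuum
open AveragingDeficitDualResidual (dualC1 dualC2)
open AveragingDeficitDerivWallProof (wallConst)
open AveragingDeficitPeriodicCounting (IsPeriodicDir)
open MinimalActionSandwich (IsMinimiser minAct)
open MinimalActionRate (sfClass)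
open MinimalActionRefine (RegularSup gradConst)
open NE3EnergyShapes (IsUnitarySite IsPeriodicSite)
open NE3.LeafIndexSockets (LeafH3sup)
open Summit.QuantumFields.BalabanUV.T4Continuum.Spine
open Summit.QuantumFields.BalabanUV.T4Continuum.Spine.NE4 (runFlow)
open Summit.QuantumFields.BalabanUV.T4Continuum.NE1p.DressedRoot (DressedTower DressedStabilityStrict)
open Summit.QuantumFields.YangMills.BalabanUVNodes.N19LedgerLinkSync (LedgerDataSync LedgerAtSync)
open YMDAG.UVSplit
open Summit.QuantumFields.YangMills.BalabanUVNodes.N16HolderDefs (CovRootHolder N16HolderAt)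
open Summit.QuantumFields.YangMills.BalabanUVNodes.SpineRatesHolder (RatesHolderAt)
open Literature.MathematicalPhysics.QuantumFieldTheory.Balaban1983to89.T4Continuum (T4Family ULoop)
open Node00 (Stage13HParams datumOfRecord₁₃CoPH SiteSeqKey U3Letters₁₁ NE3Letters₁₁ ne3ConstLayerOfRecord₁₁ ne3NperOfRecord₁₁ ne3DomOfRecord₁₁ ZetaMeasurable ppSelLiveOfRecord
  EOfRecord₁₃ wOfRecord₉ localBgMeasurable)
open Literature.MathematicalPhysics.QuantumFieldTheory.Balaban1983to89.B12Sec2to5 (betaPrime510)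
open Literature.MathematicalPhysics.QuantumFieldTheory.Balaban1983to89.Node00.U3OfKernels (objectsOfRecord₁₃ KernelDecayOfRecord₁₃)
open Literature.MathematicalPhysics.QuantumFieldTheory.Balaban1983to89.Node00.U3KernelLetters (GeometricIncrementsOfRecord₁₃ WindowedNE9OfRecord₁₃ WindowedDecayOfRecord₁₃
  WindowedStepRateOfRecord₁₃)
open Summit.QuantumFields.YangMills.BalabanUVNodes.N16PinnedLayer13CoPH (N16PinnedLoose N16LettersEnd rateCarriers_ne3_of_pinnedLoose)
open Summit.QuantumFields.YangMills.BalabanUVNodes.N19TargetClassWeightsE1Keyed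
open YMDAG.N14.TopBorn (Ne1PinnedOfRecord n14At_rateCarriersOfRecord₁₃CoPH_of_pinned)
open Summit.QuantumFields.YangMills.BalabanUVNodes.N15.GenuineRecord (fullGSizedObjects n15At_fullGSizedObjects_family)
open Summit.QuantumFields.YangMills.BalabanUVNodes.N15.AtKeyedHome (neZero_blockFactor)
open T4WeightBudget T4IndicatorShell T4ContinuumYM4Torus T4ApexHybrid
open Summit.QuantumFields.YangMills.Theses.BalabanUVNodes (SpineGivenEndpointR13SepCoPHV)
open NE7 (Target)
open Summit.QuantumFields.YangMills.BalabanUVNodes.N20OffLiveOneTermReading (crOneTerm₁₃ h20_shape_crOneTerm₁₃ h21_shape_crOneTerm₁₃ extraction_crOneTerm₁₃ core_crOneTerm₁₃_iff_target)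
open Literature.MathematicalPhysics.QuantumFieldTheory.Balaban1983to89.Node00 (MatA)
open Literature.MathematicalPhysics.QuantumFieldTheory.Balaban1983to89.Node00.LocalizedSum17 (ReadingMaps Localizes17OfRecord₁₃)
open Literature.MathematicalPhysics.QuantumFieldTheory.Balaban1983to89.Node00.Sect2 (domSys domCount CPair)
open Literature.MathematicalPhysics.QuantumFieldTheory.Balaban1983to89.Node00.W1 (ClusterTower GenTower OlderTerms olderOf recTerm truncRun toClusterTower)
open Literature.MathematicalPhysics.QuantumFieldTheory.Balaban1983to89.Node00.U3OfKernels (histPrefix)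
open Literature.MathematicalPhysics.QuantumFieldTheory.Balaban1983to89.Node00.U3KernelLetters (PolLimitsExistOfRecord₁₃)
open Literature.MathematicalPhysics.QuantumFieldTheory.Balaban1983to89.TreeLengthTorus (TPt)
open Literature.MathematicalPhysics.QuantumFieldTheory.Balaban1983to89.B12Decay510 (delta1)
open Literature.MathematicalPhysics.QuantumFieldTheory.Balaban1983to89.B12Decay510Window (K₁)
open Literature.MathematicalPhysics.QuantumFieldTheory.Balaban1983to89.B12Decay510Torus (distCT nearT)
open YMDAG.N22.KernelFading (n22At_u3OfRecord₁₃_of_genAnalyticReadingRoad1)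
variable (K₀ : ℕ) (jc : (F : T4Family) → (θ : Stage13HParams F 2) → θ.Provisos₁₃CoPH F 2 → (ℕ → ℝ) → List (ULoop F) → ℕ → ℕ)
  (sh : ShellSplit₁₃CoPH 2 K₀)
  (β : ℝ) (𝔯 : RateReading₁₃CoPH 2)
  (ℓ : (F : T4Family) → Stage13HParams F 2 → U3Letters₁₁)
  (ℓ₃ : T4Family → NE3Letters₁₁) (g B c' : T4Family → ℝ)
variable (𝔸 : (F : T4Family) → Stage13HParams F 2 → Type) (Ec : (F : T4Family) → Stage13HParams F 2 → ℕ → ℕ → Type*)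
  [∀ (F : T4Family) (θ : Stage13HParams F 2) (K k : ℕ), NormedAddCommGroup (Ec F θ K k)] [∀ (F : T4Family) (θ : Stage13HParams F 2) (K k : ℕ), NormedSpace ℂ (Ec F θ K k)]
  (m' M : (F : T4Family) → Stage13HParams F 2 → ℕ) [hM0 : ∀ (F : T4Family) (θ : Stage13HParams F 2), NeZero (M F θ)]
  (Gn : (F : T4Family) → (θ : Stage13HParams F 2) → (K : ℕ) → GenTower (F.P K) (𝔸 F θ) (M F θ))
  (emb : (F : T4Family) → (θ : Stage13HParams F 2) → ReadingMaps F (MatA 2) (𝔸 F θ))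
  (sp : (F : T4Family) → (θ : Stage13HParams F 2) → (K k : ℕ) → (domSys (F.P K) (M F θ) (k + 1)).Dom → Set (CPair (F.P K) (𝔸 F θ)))
  (κ κE δ₀ B₃ r ℓ₁ R r₀ ϱ Mb cw ω₁ : (F : T4Family) → Stage13HParams F 2 → ℝ)
  (lam : (F : T4Family) → Stage13HParams F 2 → ℕ → ℕ → ℝ) (aw : (F : T4Family) → Stage13HParams F 2 → ℕ → ℕ → ℕ → ℝ)
  (Adm : (F : T4Family) → (θ : Stage13HParams F 2) → (K k : ℕ) → OlderTerms (F.P K) (𝔸 F θ) (M F θ) k → Prop)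
  (Pot : (F : T4Family) → (θ : Stage13HParams F 2) → ℕ → ℕ → Type*)
  [∀ (F : T4Family) (θ : Stage13HParams F 2) (K k : ℕ), NormedAddCommGroup (Pot F θ K k)] [∀ (F : T4Family) (θ : Stage13HParams F 2) (K k : ℕ), NormedSpace ℂ (Pot F θ K k)]
  (ρA : (F : T4Family) → (θ : Stage13HParams F 2) → (K k : ℕ) → OlderTerms (F.P K) (𝔸 F θ) (M F θ) k → Pot F θ K k)
  (A : (F : T4Family) → (θ : Stage13HParams F 2) → (K k : ℕ) → ℝ → CPair (F.P K) (𝔸 F θ) → (domSys (F.P K) (M F θ) (k + 1)).Dom → Pot F θ K k → ℂ)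
  (ι : (F : T4Family) → (θ : Stage13HParams F 2) →
      (letI := θ.instVβ₁; letI := θ.instVβ₂;
      (K k : ℕ) → (domSys (F.P K) (M F θ) (k + 1)).Dom → ((Fin (F.P K).d → Site (F.P K) (k + 1) → θ.Vβ) →L[ℝ] Ec F θ K k)))
  (Φ : (F : T4Family) → (θ : Stage13HParams F 2) → (K k : ℕ) → (domSys (F.P K) (M F θ) (k + 1)).Dom → Ec F θ K k → CPair (F.P K) (𝔸 F θ))
  (U : (F : T4Family) → (θ : Stage13HParams F 2) → (K k : ℕ) → (domSys (F.P K) (M F θ) (k + 1)).Dom → Set (Ec F θ K k))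
  (w : (F : T4Family) → (θ : Stage13HParams F 2) → (K k : ℕ) → (domSys (F.P K) (M F θ) (k + 1)).Dom → Site (F.P K) (k + 1) → ℝ)

open Classical in
/-- ★★★ **THE ITEM `SpineGivenEndpointR13SepCoPHV` AT EVERY VERSION SLOT — LIVE: ALL PINS, NODE U3 AT THE LIMITING KERNELS OF RECORD WITH THE N22 FACE ⟸ dag-n22-c's ROAD 1 IN
GENERATOR CURRENCY WITH THE OLDER-TERM SCHEMA FROM THE ANALYTIC READING (J61 §2: (AR) `Pot ρA A` + the last-coupling first-order schema + (Adm-run) + growth `ω₁ + 4M_b c_w∕ϱ ≤ ω` + readings ∕ law ∕ (1.21) — nothing from node N18), THE N18 FACE `h18`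
DISPLAYED, N19′ AT THE BARE LEDGER READING; OFF-LIVE: ONE (B)-FREE TARGET ROW** (the base leaf's proof with `h22' :=` J61 §2).  NOT a discharge; every row a HYPOTHESIS or a decided
MODEL; NE9 ∕ NE5 NOT IN PRINT for d = 4; the schema is DISPLAYED, asserted for no family; N11 NOT READ; no node discharged; K3⁸ OPEN. [bookkeeping] -/
theorem spineGivenEndpointR13SepCoPHV_of_liveV5PinsAtCrOfRecord₁₃VAt_cut_bareLedgerReadingV_kernelFaces_n22GenAnalyticReadingRoad1_offLiveOneTerm_v5pins_bFree
    (ksel : (F : T4Family) → (θ : Stage13HParams F 2) → θ.Provisos₁₃CoPH F 2 → (ℕ → ℝ) → List (ULoop F) → ℕ)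
    (hpin1 : Ne1PinnedOfRecord 𝔯)
    (hpin2 : ∃ (b aS : ℝ) (ν μ α β' : Fin 4) (c35 p : ℝ), 0 < b ∧ 0 < aS ∧
      ∀ (F : T4Family) (θ : Stage13HParams F 2) (hP : θ.Provisos₁₃CoPH F 2) (g₀ : ℕ → ℝ) (os : List (ULoop F)) (k : ℕ),
        (𝔯.lit F θ hP g₀ os).ne2 k = haveI := neZero_blockFactor F; fullGSizedObjects 3 F.hL b aS ν μ α β' c35 p)
    (hpinL : N16PinnedLoose 𝔯 ℓ₃ B)
    (hpin : ∀ (F : T4Family) (θ : Stage13HParams F 2) (hP : θ.Provisos₁₃CoPH F 2) (g₀ : ℕ → ℝ) (os : List (ULoop F)),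
      (𝔯.lit F θ hP g₀ os).u3 = objectsOfRecord₁₃ F 2 θ.toStage13Params (ℓ F θ))
    (h16 : ∀ (F : T4Family), (∃ θ : Stage13HParams F 2, θ.Provisos₁₃CoPH F 2 ∧ (θ.ZhUnity F 2 ∧ θ.SlotsNondegenerate₁₃ F 2) ∧ θ.Admissible F 2) →
      N16HolderAt (ne3OfRecord₁₁ F { ne3ConstLayerOfRecord₁₁ F 2 (ℓ₃ F) with
        dom := {V | V ∈ ne3DomOfRecord₁₁ F 2 0 0 ∧ V ∈ sfClass 4 F.L (ne3NperOfRecord₁₁ F 0 0) ((ℓ₃ F).ε / B F) 0} }) β)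
    (hs : ∀ (F : T4Family) (θ : Stage13HParams F 2), θ.Provisos₁₃CoPH F 2 → (θ.ZhUnity F 2 ∧ θ.SlotsNondegenerate₁₃ F 2) → θ.Admissible F 2 → (ℓ F θ).Signs)
    (hκ : ∀ (F : T4Family) (θ : Stage13HParams F 2), θ.Provisos₁₃CoPH F 2 → (θ.ZhUnity F 2 ∧ θ.SlotsNondegenerate₁₃ F 2) → θ.Admissible F 2 → 0 < (ℓ F θ).κ)
    (hcr : ∀ (F : T4Family) (θ : Stage13HParams F 2), θ.Provisos₁₃CoPH F 2 → (θ.ZhUnity F 2 ∧ θ.SlotsNondegenerate₁₃ F 2) → θ.Admissible F 2 →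
      betaPrime510 4 1 (ℓ F θ).κ ≤ (ℓ F θ).cr)
    (hκ₀ : ∀ (F : T4Family) (θ : Stage13HParams F 2), θ.Provisos₁₃CoPH F 2 → (θ.ZhUnity F 2 ∧ θ.SlotsNondegenerate₁₃ F 2) → θ.Admissible F 2 → kappa₀ (4 * 2 ^ 4) (2 * 4) ≤ (ℓ F θ).κ)
    (hK : ∀ (μ ν : Fin 4) (F : T4Family) (θ : Stage13HParams F 2), θ.Provisos₁₃CoPH F 2 → (θ.ZhUnity F 2 ∧ θ.SlotsNondegenerate₁₃ F 2) → θ.Admissible F 2 →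
      KernelDecayOfRecord₁₃ F 2 θ.toStage13Params μ ν (ℓ F θ).κ)
    (h18 : ∀ (F : T4Family) (θ : Stage13HParams F 2), θ.Provisos₁₃CoPH F 2 → (θ.ZhUnity F 2 ∧ θ.SlotsNondegenerate₁₃ F 2) → θ.Admissible F 2 →
      ∀ k : ℕ, N18At (u3OfRecord₁₃ θ.toStage13Params (objectsOfRecord₁₃ F 2 θ.toStage13Params (ℓ F θ)) k))
    -- (1.21) and dag-n22-c J61 §2's binders (`…N22AtRecordOfGenAnalyticReadingRoad1` :131–:188) under `x ↦ x F θ`: leaf G4's ROAD-1 rows with the first-order older-term schema (G-T1)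
    -- and the channel table REPLACED by J57's ANALYTIC READING (AR): data `Pot ρA A`, rows `hGA hA hMbA hAdmr hρ₁` + weight table `haw haw0 hawω hcw`, `hMb0 hϱ hR`; the LAST-coupling first-order schema
    -- `hGt` (`lam ≤ ℓ₁`); ROAD 1's rows `hμω : ω₁ + 4M_b c_w∕ϱ ≤ (ℓ F θ).ω` (pub-balaban's `fade_of_radius` in the record's letters), `hℓκ`, `hrow` — NO N18 letter, NO second order, NO output bound
    (hlim : ∀ (F : T4Family) (θ : Stage13HParams F 2), θ.Provisos₁₃CoPH F 2 → (θ.ZhUnity F 2 ∧ θ.SlotsNondegenerate₁₃ F 2) → θ.Admissible F 2 → PolLimitsExistOfRecord₁₃ F 2 θ.toStage13Params)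
    (hM : ∀ (F : T4Family) (θ : Stage13HParams F 2), θ.Provisos₁₃CoPH F 2 → (θ.ZhUnity F 2 ∧ θ.SlotsNondegenerate₁₃ F 2) → θ.Admissible F 2 → M F θ = F.L ^ m' F θ)
    (hloc : ∀ (F : T4Family) (θ : Stage13HParams F 2), θ.Provisos₁₃CoPH F 2 → (θ.ZhUnity F 2 ∧ θ.SlotsNondegenerate₁₃ F 2) → θ.Admissible F 2 →
      Localizes17OfRecord₁₃ F 2 θ.toStage13Params (fun K => truncRun K (toClusterTower (Gn F θ K))) (emb F θ))
    (hκh : ∀ (F : T4Family) (θ : Stage13HParams F 2), θ.Provisos₁₃CoPH F 2 → (θ.ZhUnity F 2 ∧ θ.SlotsNondegenerate₁₃ F 2) → θ.Admissible F 2 → kappa₀ (4 * 2 ^ 4) (2 * 4) ≤ κ F θ / 2)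
    (hδ₀ : ∀ (F : T4Family) (θ : Stage13HParams F 2), θ.Provisos₁₃CoPH F 2 → (θ.ZhUnity F 2 ∧ θ.SlotsNondegenerate₁₃ F 2) → θ.Admissible F 2 → 0 < δ₀ F θ)
    (hB₃ : ∀ (F : T4Family) (θ : Stage13HParams F 2), θ.Provisos₁₃CoPH F 2 → (θ.ZhUnity F 2 ∧ θ.SlotsNondegenerate₁₃ F 2) → θ.Admissible F 2 → 0 ≤ B₃ F θ)
    (hr : ∀ (F : T4Family) (θ : Stage13HParams F 2), θ.Provisos₁₃CoPH F 2 → (θ.ZhUnity F 2 ∧ θ.SlotsNondegenerate₁₃ F 2) → θ.Admissible F 2 → 0 < r F θ)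
    (hκE : ∀ (F : T4Family) (θ : Stage13HParams F 2), θ.Provisos₁₃CoPH F 2 → (θ.ZhUnity F 2 ∧ θ.SlotsNondegenerate₁₃ F 2) → θ.Admissible F 2 → κ F θ ≤ κE F θ)
    (hAdm : ∀ (F : T4Family) (θ : Stage13HParams F 2), θ.Provisos₁₃CoPH F 2 → (θ.ZhUnity F 2 ∧ θ.SlotsNondegenerate₁₃ F 2) → θ.Admissible F 2 →
      ∀ K, ∀ gh ∈ Window θ.γ, ∀ k, Adm F θ K k (olderOf (recTerm (Gn F θ K) fun n => ((gh n : ℝ) : ℂ)) k))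
    (hGA : ∀ (F : T4Family) (θ : Stage13HParams F 2), θ.Provisos₁₃CoPH F 2 → (θ.ZhUnity F 2 ∧ θ.SlotsNondegenerate₁₃ F 2) → θ.Admissible F 2 →
      ∀ (K k : ℕ), ∀ t ∈ Set.Ioc (0 : ℝ) θ.γ, ∀ (old : OlderTerms (F.P K) (𝔸 F θ) (M F θ) k), Adm F θ K k old → ∀ (X : (domSys (F.P K) (M F θ) (k + 1)).Dom), ∀ φ ∈ sp F θ K k X,
      ((Gn F θ K) k).E ((t : ℝ) : ℂ) old φ X = A F θ K k t φ X (ρA F θ K k old))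
    (hA : ∀ (F : T4Family) (θ : Stage13HParams F 2), θ.Provisos₁₃CoPH F 2 → (θ.ZhUnity F 2 ∧ θ.SlotsNondegenerate₁₃ F 2) → θ.Admissible F 2 →
      ∀ (K k : ℕ), ∀ t ∈ Set.Ioc (0 : ℝ) θ.γ, ∀ (X : (domSys (F.P K) (M F θ) (k + 1)).Dom), ∀ φ ∈ sp F θ K k X, DifferentiableOn ℂ (A F θ K k t φ X) (Metric.ball 0 (R F θ)))
    (hMbA : ∀ (F : T4Family) (θ : Stage13HParams F 2), θ.Provisos₁₃CoPH F 2 → (θ.ZhUnity F 2 ∧ θ.SlotsNondegenerate₁₃ F 2) → θ.Admissible F 2 →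
      ∀ (K k : ℕ), ∀ t ∈ Set.Ioc (0 : ℝ) θ.γ, ∀ (X : (domSys (F.P K) (M F θ) (k + 1)).Dom), ∀ φ ∈ sp F θ K k X, ∀ p ∈ Metric.ball (0 : Pot F θ K k) (R F θ),
      ‖A F θ K k t φ X p‖ ≤ Mb F θ * Real.exp (-(κE F θ * (domSys (F.P K) (M F θ) (k + 1)).dj X)))
    (hAdmr : ∀ (F : T4Family) (θ : Stage13HParams F 2), θ.Provisos₁₃CoPH F 2 → (θ.ZhUnity F 2 ∧ θ.SlotsNondegenerate₁₃ F 2) → θ.Admissible F 2 →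
      ∀ (K k : ℕ) (old : OlderTerms (F.P K) (𝔸 F θ) (M F θ) k), Adm F θ K k old → ‖ρA F θ K k old‖ ≤ r₀ F θ)
    (hρ₁ : ∀ (F : T4Family) (θ : Stage13HParams F 2), θ.Provisos₁₃CoPH F 2 → (θ.ZhUnity F 2 ∧ θ.SlotsNondegenerate₁₃ F 2) → θ.Admissible F 2 →
      ∀ (K k : ℕ) (o o' : OlderTerms (F.P K) (𝔸 F θ) (M F θ) k), Adm F θ K k o → Adm F θ K k o' → ∀ (B' : ℝ), 0 ≤ B' →
      (∀ (k' : ℕ) (hk' : k' < k) (Y : (domSys (F.P K) (M F θ) (k' + 1)).Dom), ∀ φ' ∈ sp F θ K k' Y,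
        aw F θ K k (k' + 1) * (Real.exp (κE F θ * (domSys (F.P K) (M F θ) (k' + 1)).dj Y) * ‖o ⟨k' + 1, Nat.succ_lt_succ hk'⟩ Y φ' - o' ⟨k' + 1, Nat.succ_lt_succ hk'⟩ Y φ'‖) ≤ B') →
      ‖ρA F θ K k o - ρA F θ K k o'‖ ≤ B')
    (haw : ∀ (F : T4Family) (θ : Stage13HParams F 2), θ.Provisos₁₃CoPH F 2 → (θ.ZhUnity F 2 ∧ θ.SlotsNondegenerate₁₃ F 2) → θ.Admissible F 2 → ∀ K k j, 0 ≤ aw F θ K k j)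
    (haw0 : ∀ (F : T4Family) (θ : Stage13HParams F 2), θ.Provisos₁₃CoPH F 2 → (θ.ZhUnity F 2 ∧ θ.SlotsNondegenerate₁₃ F 2) → θ.Admissible F 2 → ∀ K k, aw F θ K k 0 = 0)
    (hawω : ∀ (F : T4Family) (θ : Stage13HParams F 2), θ.Provisos₁₃CoPH F 2 → (θ.ZhUnity F 2 ∧ θ.SlotsNondegenerate₁₃ F 2) → θ.Admissible F 2 →
      ∀ K k j, j ≤ k → aw F θ K k j ≤ cw F θ * ω₁ F θ ^ (k - j))
    (hcw : ∀ (F : T4Family) (θ : Stage13HParams F 2), θ.Provisos₁₃CoPH F 2 → (θ.ZhUnity F 2 ∧ θ.SlotsNondegenerate₁₃ F 2) → θ.Admissible F 2 → 0 ≤ cw F θ)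
    (hMb0 : ∀ (F : T4Family) (θ : Stage13HParams F 2), θ.Provisos₁₃CoPH F 2 → (θ.ZhUnity F 2 ∧ θ.SlotsNondegenerate₁₃ F 2) → θ.Admissible F 2 → 0 ≤ Mb F θ)
    (hϱ : ∀ (F : T4Family) (θ : Stage13HParams F 2), θ.Provisos₁₃CoPH F 2 → (θ.ZhUnity F 2 ∧ θ.SlotsNondegenerate₁₃ F 2) → θ.Admissible F 2 → 0 < ϱ F θ)
    (hR : ∀ (F : T4Family) (θ : Stage13HParams F 2), θ.Provisos₁₃CoPH F 2 → (θ.ZhUnity F 2 ∧ θ.SlotsNondegenerate₁₃ F 2) → θ.Admissible F 2 → r₀ F θ + ϱ F θ < R F θ)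
    (hGt : ∀ (F : T4Family) (θ : Stage13HParams F 2), θ.Provisos₁₃CoPH F 2 → (θ.ZhUnity F 2 ∧ θ.SlotsNondegenerate₁₃ F 2) → θ.Admissible F 2 →
      ∀ (K k : ℕ), ∀ t ∈ Set.Ioc (0 : ℝ) θ.γ, ∀ t' ∈ Set.Ioc (0 : ℝ) θ.γ, ∀ (old : OlderTerms (F.P K) (𝔸 F θ) (M F θ) k), Adm F θ K k old → ∀ (X : (domSys (F.P K) (M F θ) (k + 1)).Dom), ∀ φ ∈ sp F θ K k X,
      ‖((Gn F θ K) k).E ((t : ℝ) : ℂ) old φ X - ((Gn F θ K) k).E ((t' : ℝ) : ℂ) old φ X‖ ≤ Real.exp (-(κE F θ * (domSys (F.P K) (M F θ) (k + 1)).dj X)) * (lam F θ K k * |t - t'|))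
    (hlam : ∀ (F : T4Family) (θ : Stage13HParams F 2), θ.Provisos₁₃CoPH F 2 → (θ.ZhUnity F 2 ∧ θ.SlotsNondegenerate₁₃ F 2) → θ.Admissible F 2 → ∀ K k, lam F θ K k ≤ ℓ₁ F θ)
    (hℓ₁ : ∀ (F : T4Family) (θ : Stage13HParams F 2), θ.Provisos₁₃CoPH F 2 → (θ.ZhUnity F 2 ∧ θ.SlotsNondegenerate₁₃ F 2) → θ.Admissible F 2 → 0 ≤ ℓ₁ F θ)
    (hω₁ : ∀ (F : T4Family) (θ : Stage13HParams F 2), θ.Provisos₁₃CoPH F 2 → (θ.ZhUnity F 2 ∧ θ.SlotsNondegenerate₁₃ F 2) → θ.Admissible F 2 → 0 ≤ ω₁ F θ)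
    (hU : ∀ (F : T4Family) (θ : Stage13HParams F 2), θ.Provisos₁₃CoPH F 2 → (θ.ZhUnity F 2 ∧ θ.SlotsNondegenerate₁₃ F 2) → θ.Admissible F 2 → ∀ K k X, IsOpen (U F θ K k X))
    (hrU : ∀ (F : T4Family) (θ : Stage13HParams F 2), θ.Provisos₁₃CoPH F 2 → (θ.ZhUnity F 2 ∧ θ.SlotsNondegenerate₁₃ F 2) → θ.Admissible F 2 → ∀ K k X, Metric.ball (0 : Ec F θ K k) (r F θ) ⊆ U F θ K k X)
    (hEhol : ∀ (F : T4Family) (θ : Stage13HParams F 2), θ.Provisos₁₃CoPH F 2 → (θ.ZhUnity F 2 ∧ θ.SlotsNondegenerate₁₃ F 2) → θ.Admissible F 2 →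
      ∀ gh ∈ Window θ.γ, ∀ (K k : ℕ) (X : (domSys (F.P K) (M F θ) (k + 1)).Dom),
      DifferentiableOn ℂ (fun z => (truncRun K (toClusterTower (Gn F θ K)) k).E (histPrefix gh k) (Φ F θ K k X z) X) (U F θ K k X))
    (hΦemb : ∀ (F : T4Family) (θ : Stage13HParams F 2), θ.Provisos₁₃CoPH F 2 → (θ.ZhUnity F 2 ∧ θ.SlotsNondegenerate₁₃ F 2) → θ.Admissible F 2 →
      (letI := θ.instVβ₁; letI := θ.instVβ₂;
      ∀ (K k : ℕ) (X : (domSys (F.P K) (M F θ) (k + 1)).Dom) (Bf : Fin (F.P K).d → Site (F.P K) (k + 1) → θ.Vβ),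
        Φ F θ K k X (ι F θ K k X Bf) = emb F θ K k (fun l t => NormedSpace.exp (θ.ρ8 (Bf l t)))))
    (hΦsp : ∀ (F : T4Family) (θ : Stage13HParams F 2), θ.Provisos₁₃CoPH F 2 → (θ.ZhUnity F 2 ∧ θ.SlotsNondegenerate₁₃ F 2) → θ.Admissible F 2 →
      ∀ (K k : ℕ) (X : (domSys (F.P K) (M F θ) (k + 1)).Dom), ∀ z ∈ Metric.ball (0 : Ec F θ K k) (r F θ), Φ F θ K k X z ∈ sp F θ K k X)
    (hw₀ : ∀ (F : T4Family) (θ : Stage13HParams F 2), θ.Provisos₁₃CoPH F 2 → (θ.ZhUnity F 2 ∧ θ.SlotsNondegenerate₁₃ F 2) → θ.Admissible F 2 → ∀ K k X t, 0 ≤ w F θ K k X t)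
    (hw : ∀ (F : T4Family) (θ : Stage13HParams F 2), θ.Provisos₁₃CoPH F 2 → (θ.ZhUnity F 2 ∧ θ.SlotsNondegenerate₁₃ F 2) → θ.Admissible F 2 →
      (letI := θ.instVβ₁; letI := θ.instVβ₂; letI := θ.instιβ;
      ∀ (K k : ℕ) (X : (domSys (F.P K) (M F θ) (k + 1)).Dom) (l : Fin (F.P K).d) (t : Site (F.P K) (k + 1)) (cι : θ.ιβ),
        ‖ι F θ K k X (Pi.single l (Pi.single t (θ.bV cι)))‖ ≤ w F θ K k X t))
    (htail : ∀ (F : T4Family) (θ : Stage13HParams F 2), θ.Provisos₁₃CoPH F 2 → (θ.ZhUnity F 2 ∧ θ.SlotsNondegenerate₁₃ F 2) → θ.Admissible F 2 →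
      ∀ (K k : ℕ) (X : (domSys (F.P K) (M F θ) (k + 1)).Dom) (t : Site (F.P K) (k + 1)),
        let e : Site (F.P K) (k + 1) → TPt 4 (domCount (F.P K) (M F θ) (k + 1) * M F θ) := fun x i => (ZMod.cast (x i) : ZMod (domCount (F.P K) (M F θ) (k + 1) * M F θ));
        w F θ K k X t ≤ B₃ F θ * Real.exp (-δ₀ F θ * distCT (domCount (F.P K) (M F θ) (k + 1)) (M F θ) (e t) (nearT (M := M F θ) (e t) X)))
    (hμω : ∀ (F : T4Family) (θ : Stage13HParams F 2), θ.Provisos₁₃CoPH F 2 → (θ.ZhUnity F 2 ∧ θ.SlotsNondegenerate₁₃ F 2) → θ.Admissible F 2 → ω₁ F θ + 4 * Mb F θ * cw F θ / ϱ F θ ≤ (ℓ F θ).ω)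
    (hℓκ : ∀ (F : T4Family) (θ : Stage13HParams F 2), θ.Provisos₁₃CoPH F 2 → (θ.ZhUnity F 2 ∧ θ.SlotsNondegenerate₁₃ F 2) → θ.Admissible F 2 → (ℓ F θ).κ ≤ delta1 (δ₀ F θ) (κ F θ) ((M F θ : ℝ) * 4))
    (hrow : ∀ (F : T4Family) (θ : Stage13HParams F 2), θ.Provisos₁₃CoPH F 2 → (θ.ZhUnity F 2 ∧ θ.SlotsNondegenerate₁₃ F 2) → θ.Admissible F 2 →
      16 * B₃ F θ ^ 2 / r F θ ^ 2 * Real.exp (delta1 (δ₀ F θ) (κ F θ) ((M F θ : ℝ) * 4) * ((M F θ : ℝ) * 4) * 3) * B12TreeDecay.K₀ (4 * 2 ^ 4) (2 * 4) * K₁ 4 (δ₀ F θ / 2) * ℓ₁ F θ ≤ (ℓ F θ).C₉ * (ℓ F θ).ω)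
    (hβ23 : 2 / 3 < β) (hβ1 : β ≤ 1)
    (hmatch : ∀ F : T4Family, 0 < B F ∧ (ℓ₃ F).ε / B F ≤ (ℓ₃ F).b)
    (hend : N16LettersEnd 2 g ℓ₃)
    (hradii : ∀ F : T4Family, (ℓ₃ F).g = gradConst 4 (c' F) ∧ 0 ≤ c' F ∧ 0 < c' F ∧ (ℓ₃ F).b ≤ c' F ∧
      (2 : ℝ) ^ 91 * (F.L : ℝ) ^ 17 * c' F ≤ 1 ∧ (2 : ℝ) ^ 76 * (F.L : ℝ) ^ 12 * c' F ≤ (ℓ₃ F).ε ∧ (ℓ₃ F).ε / B F ≤ 1 / 4 ∧ 4 * ((ℓ₃ F).ε / B F) ≤ c' F)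
    (hclass : ∀ F : T4Family, 16 * B7Prop2Explicit.C0 4 * (ℓ₃ F).ε ≤ 3 ∧ 1024 * (4 + 1) * (4 + 4) * (F.L : ℝ) ^ 2 * (ℓ₃ F).ε ≤ 1)
    (hH3 : ∀ (F : T4Family) (θ : Stage13HParams F 2) (hP : θ.Provisos₁₃CoPH F 2) (g₀ : ℕ → ℝ) (os : List (ULoop F)) (k : ℕ),
      LeafH3sup 4 (rateCarriersOfRecord₁₃CoPH 𝔯 F θ hP g₀ os k).ne3.L (rateCarriersOfRecord₁₃CoPH 𝔯 F θ hP g₀ os k).ne3.Nper (rateCarriersOfRecord₁₃CoPH 𝔯 F θ hP g₀ os k).ne3.ε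
        (rateCarriersOfRecord₁₃CoPH 𝔯 F θ hP g₀ os k).ne3.b (c' F) (rateCarriersOfRecord₁₃CoPH 𝔯 F θ hP g₀ os k).ne3.dom)
    (hsel3 : ∀ (F : T4Family) (θ : Stage13HParams F 2) (hP : θ.Provisos₁₃CoPH F 2) (g₀ : ℕ → ℝ) (os : List (ULoop F)) (k : ℕ),
      ∃ sel : ℕ → (B7Prop1Explicit.Site 4 → Fin 4 → (Matrix (Fin 2) (Fin 2) ℂ)ˣ) → (B7Prop1Explicit.Site 4 → Fin 4 → (Matrix (Fin 2) (Fin 2) ℂ)ˣ),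
        (∀ V ∈ (rateCarriersOfRecord₁₃CoPH 𝔯 F θ hP g₀ os k).ne3.dom, ∀ j : ℕ,
          IsMinimiser 4 (sfClass 4 (rateCarriersOfRecord₁₃CoPH 𝔯 F θ hP g₀ os k).ne3.L (rateCarriersOfRecord₁₃CoPH 𝔯 F θ hP g₀ os k).ne3.Nper (rateCarriersOfRecord₁₃CoPH 𝔯 F θ hP g₀ os k).ne3.ε)
            (rateCarriersOfRecord₁₃CoPH 𝔯 F θ hP g₀ os k).ne3.L (rateCarriersOfRecord₁₃CoPH 𝔯 F θ hP g₀ os k).ne3.Nper j V (sel j V)) ∧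
        (∀ V ∈ (rateCarriersOfRecord₁₃CoPH 𝔯 F θ hP g₀ os k).ne3.dom, ∀ j : ℕ,
          RegularSup 4 (rateCarriersOfRecord₁₃CoPH 𝔯 F θ hP g₀ os k).ne3.L (rateCarriersOfRecord₁₃CoPH 𝔯 F θ hP g₀ os k).ne3.Nper (rateCarriersOfRecord₁₃CoPH 𝔯 F θ hP g₀ os k).ne3.b (c' F) j (sel j V)))
    (hβw : ∀ (F : T4Family) (θ : Stage13HParams F 2) (hP : θ.Provisos₁₃CoPH F 2), (θ.ZhUnity F 2 ∧ θ.SlotsNondegenerate₁₃ F 2) → θ.Admissible F 2 →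
      ∃ γ₀ b b' : ℝ, 0 < γ₀ ∧ 0 < b ∧ DagBinding.BetaBoundsInInterval (datumOfRecord₁₃CoPH F 2 θ hP).C.toB12 γ₀ b b')
    (hζm : ∀ (F : T4Family) (θ : Stage13HParams F 2), θ.Provisos₁₃CoPH F 2 → ((θ.ZhUnity F 2 ∧ θ.SlotsNondegenerate₁₃ F 2) ∧ θ.ppSel = ppSelLiveOfRecord F 2 θ.ν θ.τ9 (EOfRecord₁₃ F 2 θ.toStage13Params) (wOfRecord₉ F 2 θ.toStage9Params)) → θ.Admissible F 2 →
      ZetaMeasurable F 2 θ.ζ)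
    (h20 : ∀ (F : T4Family) (θ : Stage13HParams F 2) (hP : θ.Provisos₁₃CoPH F 2), ((θ.ZhUnity F 2 ∧ θ.SlotsNondegenerate₁₃ F 2) ∧ θ.ppSel = ppSelLiveOfRecord F 2 θ.ν θ.τ9 (EOfRecord₁₃ F 2 θ.toStage13Params) (wOfRecord₉ F 2 θ.toStage9Params)) → θ.Admissible F 2 →
      ∀ (g₀ : ℕ → ℝ) (os : List (ULoop F)),
        ∃ W : ℕ → ℝ, RelWeightBound 1 (classSet₁₃ θ K₀ g₀) (weightA₁₃ θ hP K₀ g₀ os) (weightB₁₃ θ hP K₀ g₀ os) (badClass₁₃ θ K₀ g₀ (jc F θ hP g₀ os)) W)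
    (h21 : ∀ (F : T4Family) (θ : Stage13HParams F 2) (hP : θ.Provisos₁₃CoPH F 2), ((θ.ZhUnity F 2 ∧ θ.SlotsNondegenerate₁₃ F 2) ∧ θ.ppSel = ppSelLiveOfRecord F 2 θ.ν θ.τ9 (EOfRecord₁₃ F 2 θ.toStage13Params) (wOfRecord₉ F 2 θ.toStage9Params)) → θ.Admissible F 2 →
      ∀ (g₀ : ℕ → ℝ) (os : List (ULoop F)),
        ∃ Wsh : ℕ → ℝ, ShellWeightBound 1 (classSet₁₃ θ K₀ g₀) (weightA₁₃ θ hP K₀ g₀ os) (weightB₁₃ θ hP K₀ g₀ os) (sh F θ hP g₀ os).1 (sh F θ hP g₀ os).2 Wsh)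
    (hlinkBareV : ∀ (F : T4Family) (θ : Stage13HParams F 2) (hP : θ.Provisos₁₃CoPH F 2), ((θ.ZhUnity F 2 ∧ θ.SlotsNondegenerate₁₃ F 2) ∧ θ.ppSel = ppSelLiveOfRecord F 2 θ.ν θ.τ9 (EOfRecord₁₃ F 2 θ.toStage13Params) (wOfRecord₉ F 2 θ.toStage9Params)) → θ.Admissible F 2 →
      ∀ (γ gIR b : ℝ) (g₀ : ℕ → ℝ), (datumOfRecord₁₃CoPH F 2 θ hP).Tuned γ gIR g₀ → γ ≤ θ.γ → γ ^ 2 ≤ Real.exp (-1) → 0 < b →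
      (∀ K m, 0 ≤ m → m < K → b ≤ (datumOfRecord₁₃CoPH F 2 θ hP).βfun m (prefixOf (runFlow (datumOfRecord₁₃CoPH F 2 θ hP) g₀ K) m)) →
      ∀ (os : List (ULoop F)) (k : ℕ),
      let S : SpineCarriers := crOfRecord₁₃VAt K₀ (jc F θ hP g₀ os) sh F θ hP g₀ os
      let R : RateCarriers 2 := rateCarriersOfRecord₁₃CoPH 𝔯 F θ hP g₀ os k
      let D : Datum F 2 := datumOfRecord₁₃CoPH F 2 θ hP
      letI := S.dec
      ∃ (_ : DecidableEq R.u3.C.Dom) (F' : Type) (ι' X' : Type) (_ : MeasurableSpace ι')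
        (L : LedgerDataSync R.u3.C F' ι' S.ι) (Rd : Readings ι' X') (bsel : (ℕ → ℝ) → ℝ) (EB : Functional R.u3.C R.u3.C.BgB)
        (g : ℕ → ℕ → ℝ)
        (uA : ℕ → ι' → R.u3.C.BgA) (uB : ℕ → ι' → R.u3.C.BgB)
        (Koff : ℕ) (cells : (K j : ℕ) → R.u3.C.Dom → Finset (Site (F.P (Koff + K)) j))
        (θ : ℝ)
        (rd : ι' → (B7Prop1Explicit.Site 4 → Fin 4 → (Matrix (Fin 2) (Fin 2) ℂ)ˣ)),
        (∀ K i, i ≤ K → g K i = runFlow D g₀ K i) ∧ (∀ K i, K < i → g K i = gIR) ∧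
        EB = (fun s => R.u3.EB (bsel s) s) ∧
        (∀ (Sz : ℕ → ℝ → S.ι → ℕ → ℝ) (E₀ : ℝ) (m : ℕ) (a : ℝ) (Cw Λg : ℝ),
          (∀ K t, |t| ≤ S.l₀ → ∀ τ ∈ S.T K \ S.Bad K t, ∀ v ∈ Rd.dom, ∀ j ≤ K,
            |∑ X ∈ L.fac K t τ with R.u3.C.scale X = j,
                (Real.log (Real.exp (EB (fun i => g (K + 1) (i + 1)) (uB K v) X
                    - EB (fun i => g (K + 1) (i + 1)) L.oneB X))
                  - Real.log (Real.exp (R.u3.EA (g K) (uA K v) X - R.u3.EA (g K) L.oneA X)))| ≤ Sz K t τ j) →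
          0 ≤ E₀ → 0 < a → a < 1 →
          (∀ K t, |t| ≤ S.l₀ → ∀ τ ∈ S.T K \ S.Bad K t, ∀ j ≤ K,
            Sz K t τ j ≤ S.vol * (E₀ * ((K : ℝ) + 1) ^ m * a ^ (K - j))) →
          (∀ K, Multiplicity (L.All K) R.u3.C.scale (fun X => Real.exp (-(R.u3.κ * R.u3.C.d X))) Cw S.vol Λg K) →
          (∀ K t, |t| ≤ S.l₀ → ∀ τ ∈ S.T K \ S.Bad K t,
            WindowMultiplicity (L.facO K t τ) L.scO L.wO Cw S.vol Λg (jlogOf L.Cl K) K) →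
          1 ≤ Λg → L.θ' ≤ Λg →
          LedgerAtSync { L with S := Sz, E₀ := E₀, m := m, a := a, Cw := Cw, Λg := Λg } S.l₀ S.vol S.T S.Bad
            (fun K t τ => S.A K t τ - S.shA K t τ) (fun K t τ => S.B K t τ - S.shB K t τ) Rd R.u3.EA EB R.u3.κ g uA uB
            R.u3.ω R.u3.ρ R.u3.θ (θ ^ ((3 : ℝ) * β - 2))) ∧
        (∀ K t, |t| ≤ S.l₀ → ∀ τ ∈ S.T K \ S.Bad K t,
          WindowMultiplicity (L.facO K t τ) L.scO L.wO L.Cw S.vol L.Λg (jlogOf L.Cl K) K) ∧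
        0 ≤ L.Cw ∧ 1 ≤ L.Λg ∧ L.θ' ≤ L.Λg ∧
        (∀ K, ∀ X ∈ L.All K,
          (cells K (R.u3.C.scale X + Koff) X).Nonempty ∧ TFaceConnected (cells K (R.u3.C.scale X + Koff) X)) ∧
        (∀ K j, Set.InjOn (cells K j) ↑((L.All K).filter fun X => R.u3.C.scale X + Koff = j)) ∧
        (∀ K, ∀ X ∈ L.All K, torusTreeLen (cells K (R.u3.C.scale X + Koff) X) ≤ R.u3.C.d X) ∧
        0 < θ ∧ θ ^ 6 = ((R.ne3.L : ℝ))⁻¹ ∧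
        (∀ v ∈ Rd.dom, rd v ∈ R.ne3.dom) ∧
        (∀ k, ∀ v ∈ Rd.dom, Rd.act k v = minAct 4 (sfClass 4 R.ne3.L R.ne3.Nper R.ne3.ε) R.ne3.L R.ne3.Nper k (rd v)) ∧
        (R.ne3.Nper : ℝ) ^ 4 ≤ Rd.vol ∧
        (∀ s ∈ Window γ, 0 < bsel s ∧ bsel s ≤ γ))
    (htarget : ∀ (F : T4Family) (θ : Stage13HParams F 2) (hP : θ.Provisos₁₃CoPH F 2), ((θ.ZhUnity F 2 ∧ θ.SlotsNondegenerate₁₃ F 2) ∧ ¬ θ.ppSel = ppSelLiveOfRecord F 2 θ.ν θ.τ9 (EOfRecord₁₃ F 2 θ.toStage13Params) (wOfRecord₉ F 2 θ.toStage9Params)) → θ.Admissible F 2 →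
        ForSmallCouplings (datumOfRecord₁₃CoPH F 2 θ hP) fun g₀ => ∀ os : List (ULoop F),
          (RatesHolderAt (datumOfRecord₁₃CoPH F 2 θ hP) (rateCarriersOfRecord₁₃CoPH 𝔯 F θ hP g₀ os (ksel F θ hP g₀ os)) β ∧
              ReadOutAt (datumOfRecord₁₃CoPH F 2 θ hP) (rateCarriersOfRecord₁₃CoPH 𝔯 F θ hP g₀ os (ksel F θ hP g₀ os)).u3 ∧
              (0 ≤ (rateCarriersOfRecord₁₃CoPH 𝔯 F θ hP g₀ os (ksel F θ hP g₀ os)).u3.ρ ∧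
                (rateCarriersOfRecord₁₃CoPH 𝔯 F θ hP g₀ os (ksel F θ hP g₀ os)).u3.ρ < 1)) →
            ∃ δ : ℕ → ℝ, Target ((F.side : ℝ) ^ 4) 1 δ (fun K => T4GenFunBounds.schemeZ ((datumOfRecord₁₃CoPH F 2 θ hP).scheme g₀) os (K₀ + K))) :
    SpineGivenEndpointR13SepCoPHV := by
  have hρ : ∀ (F : T4Family) (θ : Stage13HParams F 2), θ.Provisos₁₃CoPH F 2 → (θ.ZhUnity F 2 ∧ θ.SlotsNondegenerate₁₃ F 2) → θ.Admissible F 2 →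
      0 ≤ (ℓ F θ).ρ ∧ (ℓ F θ).ρ < 1 := fun F θ hP hG hθ => ⟨(hs F θ hP hG hθ).ρ_nonneg, (hs F θ hP hG hθ).ρ_lt_one⟩
  have h22' : ∀ (F : T4Family) (θ : Stage13HParams F 2), θ.Provisos₁₃CoPH F 2 → (θ.ZhUnity F 2 ∧ θ.SlotsNondegenerate₁₃ F 2) → θ.Admissible F 2 →
      ∀ k : ℕ, N22At (u3OfRecord₁₃ θ.toStage13Params (objectsOfRecord₁₃ F 2 θ.toStage13Params (ℓ F θ)) k) := fun F θ hP hG hθ k =>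
    n22At_u3OfRecord₁₃_of_genAnalyticReadingRoad1 F 2 θ.toStage13Params (ℓ F θ) (hs F θ hP hG hθ) hθ.toStage12.toStage9.gamma_pos (hlim F θ hP hG hθ) (m' F θ) (M F θ) (hM F θ hP hG hθ)
      (Gn F θ) (emb F θ) (hloc F θ hP hG hθ) (sp F θ) (hκh F θ hP hG hθ) (hδ₀ F θ hP hG hθ) (hB₃ F θ hP hG hθ) (hr F θ hP hG hθ) (hκE F θ hP hG hθ) (Adm F θ) (hAdm F θ hP hG hθ) (ρA F θ)
      (A F θ) (hGA F θ hP hG hθ) (hA F θ hP hG hθ) (hMbA F θ hP hG hθ) (hAdmr F θ hP hG hθ) (hρ₁ F θ hP hG hθ) (haw F θ hP hG hθ) (haw0 F θ hP hG hθ) (hawω F θ hP hG hθ) (hcw F θ hP hG hθ)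
      (hMb0 F θ hP hG hθ) (hϱ F θ hP hG hθ) (hR F θ hP hG hθ) (hGt F θ hP hG hθ) (hlam F θ hP hG hθ) (hℓ₁ F θ hP hG hθ) (hω₁ F θ hP hG hθ) (Ec F θ) (ι F θ) (Φ F θ) (U F θ) (hU F θ hP hG hθ)
      (hrU F θ hP hG hθ) (hEhol F θ hP hG hθ) (hΦemb F θ hP hG hθ) (hΦsp F θ hP hG hθ) (w F θ) (hw₀ F θ hP hG hθ) (hw F θ hP hG hθ) (htail F θ hP hG hθ) (hμω F θ hP hG hθ) (hℓκ F θ hP hG hθ)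
      (hrow F θ hP hG hθ) k
  exact fun F θ h v hG hθ _ _ =>
    hybridNE7Under_of_forSmallCouplings_stringwise (Node00.datumOfRecord₁₃SepCoPHV F 2 θ h v)
      (show ForSmallCouplings (Node00.datumOfRecord₁₃SepCoPHV F 2 θ h v) (fun g₀ => StringwiseHybridNE7 ((Node00.datumOfRecord₁₃SepCoPHV F 2 θ h v).scheme g₀)) from
        bodyBFree₁₃CoPH_of_split (fun F (θ : Stage13HParams F 2) => (θ.ZhUnity F 2 ∧ θ.SlotsNondegenerate₁₃ F 2)) (fun F (θ : Stage13HParams F 2) => θ.ppSel = ppSelLiveOfRecord F 2 θ.ν θ.τ9 (EOfRecord₁₃ F 2 θ.toStage13Params) (wOfRecord₉ F 2 θ.toStage9Params))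
          (bodyBFree₁₃CoPH_of_v5pins_bareLedgerReadingV_kernelFaces_at_crOfRecord₁₃VAt_cut K₀ jc sh β 𝔯 ℓ ℓ₃ g B c'
          (fun F (θ : Stage13HParams F 2) => (θ.ZhUnity F 2 ∧ θ.SlotsNondegenerate₁₃ F 2) ∧ θ.ppSel = ppSelLiveOfRecord F 2 θ.ν θ.τ9 (EOfRecord₁₃ F 2 θ.toStage13Params) (wOfRecord₉ F 2 θ.toStage9Params))
          ksel hpin1 hpin2 hpinL hpin (fun F hF => h16 F (hF.elim fun θ h => ⟨θ, h.1, h.2.1.1, h.2.2⟩)) (fun F θ hP hRg hθ => hs F θ hP hRg.1 hθ) (fun F θ hP hRg hθ => hκ F θ hP hRg.1 hθ)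
          (fun F θ hP hRg hθ => hcr F θ hP hRg.1 hθ) (fun F θ hP hRg hθ => hκ₀ F θ hP hRg.1 hθ) (fun μ ν F θ hP hRg hθ => hK μ ν F θ hP hRg.1 hθ) (fun F θ hP hRg hθ => h18 F θ hP hRg.1 hθ)
          (fun F θ hP hRg hθ => h22' F θ hP hRg.1 hθ) hβ23 hβ1 hmatch hend hradii hclass hH3 hsel3
          (fun F θ hP hRg hθ => hβw F θ hP hRg.1 hθ) (fun _ _ _ hRg _ => ⟨_, hRg.2⟩) hζm h20 h21 hlinkBareV)
          (bodyBFree₁₃CoPH_of_kernels_pin_bFree (crOneTerm₁₃ K₀) 𝔯 ksel (fun {F} (θ : Stage13HParams F 2) => ((θ.ZhUnity F 2 ∧ θ.SlotsNondegenerate₁₃ F 2) ∧ ¬ θ.ppSel = ppSelLiveOfRecord F 2 θ.ν θ.τ9 (EOfRecord₁₃ F 2 θ.toStage13Params) (wOfRecord₉ F 2 θ.toStage9Params))) ℓ β hpin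
            (fun F θ hP hRg hθ => ForSmallCouplings.of_forall fun g₀ os => by
              refine ⟨?_, ?_, ?_⟩
              · exact n14At_rateCarriersOfRecord₁₃CoPH_of_pinned 𝔯 hpin1 F θ hP g₀ os (ksel F θ hP g₀ os)
              · obtain ⟨b, aS, ν, μ, α, β', c35, p, hb, haS, h⟩ := hpin2
                rw [h F θ hP g₀ os]
                exact n15At_fullGSizedObjects_family hb haS ν μ α β' c35 p F
              · show N16HolderAt (rateCarriersOfRecord₁₃CoPH 𝔯 F θ hP g₀ os (ksel F θ hP g₀ os)).ne3 β
                rw [rateCarriers_ne3_of_pinnedLoose hpinL F θ hP g₀ os (ksel F θ hP g₀ os)]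
                exact h16 F ⟨θ, hP, hRg.1, hθ⟩)
            (fun F θ hP hRg hθ => hs F θ hP hRg.1 hθ) (fun F θ hP hRg hθ => hκ F θ hP hRg.1 hθ) (fun F θ hP hRg hθ => hcr F θ hP hRg.1 hθ)
            (fun F θ hP hRg hθ => hρ F θ hP hRg.1 hθ) (h20_shape_crOneTerm₁₃ K₀) (h21_shape_crOneTerm₁₃ K₀)
            (fun F θ hP hRg hθ => (htarget F θ hP hRg hθ).mono fun g₀ hg os hPr =>
              (core_crOneTerm₁₃_iff_target K₀ θ hP g₀ os).2 (hg os hPr))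
            (fun _ θ hP _ _ => ForSmallCouplings.of_forall fun g₀ os => extraction_crOneTerm₁₃ K₀ θ hP g₀ os)
            (fun F θ hP hRg hθ => hK 0 1 F θ hP hRg.1 hθ) (fun F θ hP hRg hθ => h18 F θ hP hRg.1 hθ)
            (fun F θ hP hRg hθ => h22' F θ hP hRg.1 hθ))
          F θ h.toCore hG hθ) _

end Summit.QuantumFields.YangMills.Theorems.BalabanUVNodesN27SpineRecord
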